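import Summits.BirchSwinnertonDyer.BirchSwinnertonDyer.Theorems.PrintCf2RubinValueTwoEllipticUnitsLocalTower
import Literature.NumberTheory.ComplexMultiplication.EllipticUnits.RingOfIntegersPeriodLattice
import HarnessLib

/-!
# The elliptic units `e(𝔞) ∈ 𝒰_𝔓` EXIST UNCONDITIONALLY in the period-lattice input (de Shalit II.4.5 (12) at one `𝔓`):
# the hypothesis «a period pair with lattice `ι(𝔪)`» of `…EllipticUnitsLocalTower` discharged by `exists_periodPair_mem_iff_ideal`

Cell `bsd-print-cf2`, width seat `bsd-line-cf2c-w4` g10; `--supports` stmt-BirchSwinnertonDyer-24721 (helper, Theses-free). THEOREMS ONLY;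
CONDITIONAL on the de Shalit II.2.4 (i), (iii), II.2.5 (i) named facts (hypotheses, never asserted).  `PrintCf2RubinValueTwoEllipticUnitsLocalTower`
proved `exists_forall_isThetaValueOne` / `exists_relNormCoherentUnits_isThetaValueOne` from ONE period pair with lattice `ι(𝔪)` (hypothesis
`hL₀`); the Literature file `EllipticUnits/RingOfIntegersPeriodLattice` (cf2c-w4 g10) constructs such a pair for every `𝔪 ≠ 0` of an imaginary
quadratic `K`.  THIS file removes `hL₀`:

* `exists_forall_isThetaValueOne'` — for `K` imaginary quadratic, `𝔪 ≠ 0`, `𝔞 ≠ 0` prime to `𝔪v`, GIVEN II.2.4 (i): a family `x_m ∈ K(𝔪v^{m+1})`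
  with `ι̂ x_m = Θ(1; 𝔪v^{m+1}, 𝔞)` for all `m`;
* ★ `exists_relNormCoherentUnits_isThetaValueOne'` — GIVEN II.2.4 (i), (iii), II.2.5 (i): `∃ β ∈ 𝒰_𝔓` with components `ι_v(x_m)` — de Shalit's
  `β(𝔞) ∈ 𝒰` on the `𝔓`-component, no lattice hypothesis left.

HONEST FRAMING: bookkeeping; nothing here closes a crux; no summit statement is proved; BSD is not proved by any of this.

## References
* [deShalit1987] E. de Shalit, *Iwasawa theory of elliptic curves with complex multiplication* (1987), II.4.5 (12) (p. 58), II.2.3 (10) (p. 42).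
-/

-- the summit namespace `Summit.BirchSwinnertonDyer.BirchSwinnertonDyer` repeats the problem name by design (D-0017)
set_option linter.dupNamespace false
set_option autoImplicit false

noncomputable section

open scoped Classical
open scoped NumberField
open Field IsDedekindDomain IsDedekindDomain.HeightOneSpectrum ValuativeRel
open Literature.NumberTheory.NumberFields
open Literature.NumberTheory.GaloisRepresentations Literature.NumberTheory.GaloisRepresentations.IsNonarchimedeanLocalField
  Literature.NumberTheory.GaloisRepresentations.LubinTate Literature.NumberTheory.GaloisRepresentations.ArtinLocalGlobal
open Literature.NumberTheory.EllipticCurves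
open Literature.NumberTheory.ComplexMultiplication.EllipticUnits

namespace Summit.BirchSwinnertonDyer.BirchSwinnertonDyer.Theorems.PrintCf2.EllipticUnitsLocal

variable {K : Type} [Field K] [NumberField K] {𝔪 : Ideal (𝓞 K)} {v : HeightOneSpectrum (𝓞 K)}

attribute [local instance] ltNormUniformSpace ltNormIsUniformAddGroup rk1 nF nE fintypeResidueField

/-- **The elliptic-unit family exists** (no period-lattice hypothesis): for `K` imaginary quadratic, `𝔪 ≠ 0`, `𝔞 ≠ 0` prime to `𝔪v`, GIVEN
II.2.4 (i), there are `x_m ∈ K(𝔪v^{m+1})` with `ι̂ x_m = Θ(1; 𝔪v^{m+1}, 𝔞)`. [cite: deShalit1987, II.2.4 Proposition (i), II.4.5 (p. 58)] -/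
theorem exists_forall_isThetaValueOne' (h24i : DeShalit1987.prop24_i_mem_rayClassField) (hK : IsImaginaryQuadratic K) (ι : K →+* ℂ)
    (h𝔪0 : 𝔪 ≠ ⊥) (v : HeightOneSpectrum (𝓞 K)) {𝔞 : Ideal (𝓞 K)} (h𝔞0 : 𝔞 ≠ ⊥) (h𝔞c : IsCoprime 𝔞 (𝔪 * v.asIdeal)) :
    ∃ x : ∀ m : ℕ, rayClassField K (𝔪 * v.asIdeal ^ (m + 1)),
      ∀ m, IsThetaValueOne ι (𝔪 * v.asIdeal ^ (m + 1)) 𝔞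
        (algClosureEmb ι ((x m : rayClassField K (𝔪 * v.asIdeal ^ (m + 1))) : AlgebraicClosure K)) := by
  obtain ⟨L₀, hL₀⟩ := exists_periodPair_mem_iff_ideal hK ι h𝔪0
  exact exists_forall_isThetaValueOne h24i hK ι h𝔪0 v h𝔞0 h𝔞c hL₀

section Local


variable [NumberField.IsTotallyComplex K]
  (h24iii : DeShalit1987.prop24_iii_unit) (h25 : DeShalit1987.prop25_i_normRelation) (hK : IsImaginaryQuadratic K) (ι : K →+* ℂ)
  (h𝔪0 : 𝔪 ≠ ⊥) (h𝔪1 : 𝔪 ≠ ⊤) (hv : ¬ 𝔪 ≤ v.asIdeal) (hw : ∀ u : (𝓞 K)ˣ, (u : 𝓞 K) - 1 ∈ 𝔪 → u = 1)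
  {π : 𝒪[v.adicCompletion K]} (hπ : (valuation (v.adicCompletion K)).IsUniformizer (π : v.adicCompletion K))
  {α : 𝓞 K} (hα0 : α ≠ 0) (hα𝔪 : α - 1 ∈ 𝔪) (hαw : ∀ w : HeightOneSpectrum (𝓞 K), w ≠ v → α ∉ w.asIdeal)
  {f : ℕ} (hαπ : ((α : K) : v.adicCompletion K) = (π : v.adicCompletion K) ^ f)
  (E : IntermediateField (v.adicCompletion K) (AlgebraicClosure (v.adicCompletion K)))
  [FiniteDimensional (v.adicCompletion K) E] [IsGalois (v.adicCompletion K) E] (hE : E ≤ maxUnramified (v.adicCompletion K))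
  (hdegE : ∀ w : WeilGroup (v.adicCompletion K),
    WeilGroup.toAbsGalois (v.adicCompletion K) w ∈ E.fixingSubgroup → (f : ℤ) ∣ WeilGroup.deg w)
  {𝔞 : Ideal (𝓞 K)} (h𝔞0 : 𝔞 ≠ ⊥) (h𝔞c : IsCoprime 𝔞 (𝔪 * v.asIdeal))

include h24iii h25 hK h𝔪0 h𝔪1 hv hw hα0 hα𝔪 hαw hαπ hE hdegE h𝔞0 h𝔞c in
/-- ★ **de Shalit's `β(𝔞) ∈ 𝒰` on the `𝔓`-component, EXISTENCE with no lattice hypothesis**: GIVEN II.2.4 (i), (iii), II.2.5 (i) there is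
`β ∈ 𝒰_𝔓 = RelNormCoherentUnits hπ E` whose components are `ι_v(x_m)`, `x_m ∈ K(𝔪v^{m+1})`, `ι̂ x_m = Θ(1; 𝔪v^{m+1}, 𝔞)`.
[cite: deShalit1987, II.4.5 (12) (p. 58), II.2.4 (i), (iii), II.2.5 (i)] -/
theorem exists_relNormCoherentUnits_isThetaValueOne' (h24i : DeShalit1987.prop24_i_mem_rayClassField) :
    ∃ (x : ∀ m : ℕ, rayClassField K (𝔪 * v.asIdeal ^ (m + 1))) (β : RelNormCoherentUnits hπ E),
      (∀ m, IsThetaValueOne ι (𝔪 * v.asIdeal ^ (m + 1)) 𝔞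
        (algClosureEmb ι ((x m : rayClassField K (𝔪 * v.asIdeal ^ (m + 1))) : AlgebraicClosure K))) ∧
      ∀ m, (((β.val m : unitBall (E ⊔ ltField π m : IntermediateField (v.adicCompletion K) (AlgebraicClosure (v.adicCompletion K)))) :
          (E ⊔ ltField π m : IntermediateField (v.adicCompletion K) (AlgebraicClosure (v.adicCompletion K)))) :
        AlgebraicClosure (v.adicCompletion K)) =
        absClosureEmbedding K (v.adicCompletion K) ((x m : rayClassField K (𝔪 * v.asIdeal ^ (m + 1))) : AlgebraicClosure K) := by
  obtain ⟨L₀, hL₀⟩ := exists_periodPair_mem_iff_ideal hK ι h𝔪0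
  exact exists_relNormCoherentUnits_isThetaValueOne h24iii h25 hK ι h𝔪0 h𝔪1 hv hw hπ hα0 hα𝔪 hαw hαπ E hE hdegE h𝔞0 h𝔞c h24i hL₀

end Local

end Summit.BirchSwinnertonDyer.BirchSwinnertonDyer.Theorems.PrintCf2.EllipticUnitsLocal

end
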